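import Summits.Ventures.KdS.SpinFlipIntertwine
import Literature.Analysis.ODE.HeunDerivative
import HarnessLib

/-!
# Venture KdS — analysis toolkit for the Teukolsky–Starobinsky transfer (V): Frobenius-polynomial
# solutions `Σ_k c_k (w−1)^{μ+k}` of Heun's equation on `(1, b)` and their formal Euler partner

HONEST FRAMING (venture `Summits/Ventures/KdS`, cell `pub-kds`; LIT-1 g22 under lead ruling A86):
general-Heun ANALYSIS in Umetsu's normalisation (`GeneralHeun.IsSolutionOn`), nothing about
Kerr–de Sitter. For a finitely supported coefficient sequence `c` and an exponent `μ` consider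
`F(w) = Σ_{k<K} c_k (w−1)^{μ+k}` on `w > 1` (principal powers of the positive real `w − 1`;
`cpowSum`). This file proves:

* `heunOp_cpowSum`: with the closed forms `cpowSum₁`, `cpowSum₂` of `F′`, `F″`
  (`hasDerivAt_cpowSum`, `hasDerivAt_cpowSum₁`),
  `lead·F″ + mid·F′ + low·F = (w−1)^{μ−1} · symbolSum(w−1)` where
  `symbolSum(t) = Σ_k c_k t^k (X₀(μ+k) + X₁(μ+k)t + X₂(μ+k)t²)` is built from the monomial symbol of
  `SpinFlipIntertwine.lean`;
* `symbolSum_eq_sum_recCoeff`: `symbolSum(t) = Σ_n recCoeff_n t^n` (the three-term recurrence);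
* `isSolutionOn_cpowSum` / `symbolSum_eq_zero_of_isSolutionOn`: `F` solves Heun's equation on
  `(1, b)` iff the symbol vanishes there, iff (`recCoeff_eq_zero_of_isSolutionOn`) every recurrence
  coefficient vanishes (a polynomial with infinitely many roots is zero);
* `isSolutionOn_partner`: **the formal Euler transform of a Frobenius-polynomial solution is a
  solution** — if `Σ_{k≤D} c_k (w−1)^{ρ+k}` solves `Hn(a_H; α,β; γ,δ,ε; q)` on some `(1,b)`, `b > 1`,
  with `ρ = 1−δ`, the Fuchs relation and `(η−α)(η−β) = 0`, then
  `Σ_{k≤D} b_k (w−1)^{ρ+η−1+k}` (partner coefficients of `SpinFlipIntertwine`) solves Takemura's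
  image equation on every `(1, b′)` — no condition on `Re ρ` (where the Euler integral itself would
  diverge);
* `coeff_eq_zero_of_cpowSum_eq_zero`: `F ≡ 0` on `(1,b)` forces `c_k = 0` (`k < K`).

0 cited facts, no `sorry`.
-/

noncomputable section

open Set Complex Filter Topology Finset Polynomial

namespace Summit.Ventures.KdS

namespace SpinFlipTS

open Literature.Analysis.ODE Literature.Analysis.ODE.GeneralHeun

/-! ### Powers of `w − 1` -/

/-- `d/dw (w − 1)^p = (w − 1)^p · p/(w − 1)` for `w > 1` (principal power of a positive real). -/
private theorem hasDerivAt_sub_one_cpow (p : ℂ) {r : ℝ} (hr : 1 < r) :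
    HasDerivAt (fun x : ℝ => ((x - 1 : ℝ) : ℂ) ^ p)
      (((r - 1 : ℝ) : ℂ) ^ p * (p / ((r : ℂ) - 1))) r := by
  have hpos : (0 : ℝ) < r - 1 := sub_pos.2 hr
  have hslit : ((r : ℂ) - 1) ∈ slitPlane := by
    have : ((r - 1 : ℝ) : ℂ) ∈ slitPlane := Complex.ofReal_mem_slitPlane.2 hpos
    simpa using this
  have hne : ((r : ℂ) - 1) ≠ 0 := by
    have : ((r - 1 : ℝ) : ℂ) ≠ 0 := by exact_mod_cast hpos.ne'
    simpa using this
  have h1 : HasDerivAt (fun z : ℂ => (z - 1) ^ p) (p * ((r : ℂ) - 1) ^ (p - 1) * 1) (r : ℂ) :=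
    ((hasDerivAt_id (r : ℂ)).sub_const (1 : ℂ)).cpow_const hslit
  have hfun : (fun x : ℝ => ((x - 1 : ℝ) : ℂ) ^ p) = fun y : ℝ => ((y : ℂ) - 1) ^ p := by
    funext y; push_cast; ring_nf
  rw [hfun]
  refine h1.comp_ofReal.congr_deriv ?_
  rw [mul_one, Complex.cpow_sub _ _ hne, Complex.cpow_one]
  push_cast
  field_simp

/-- A positive real base has non-vanishing principal powers. -/
private theorem sub_one_cpow_ne_zero (p : ℂ) {w : ℝ} (hw : 1 < w) : ((w - 1 : ℝ) : ℂ) ^ p ≠ 0 :=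
  fun h => absurd (Complex.cpow_eq_zero_iff _ _ |>.mp h).1 (by exact_mod_cast (sub_pos.2 hw).ne')

/-! ### The Frobenius sums and their derivatives -/

/-- `F(w) = Σ_{k<K} c_k (w−1)^{μ+k}`. -/
def cpowSum (μ : ℂ) (c : ℕ → ℂ) (K : ℕ) (w : ℝ) : ℂ :=
  ∑ k ∈ range K, c k * ((w - 1 : ℝ) : ℂ) ^ (μ + k)

/-- Closed form of `F′` on `w > 1`. -/
def cpowSum₁ (μ : ℂ) (c : ℕ → ℂ) (K : ℕ) (w : ℝ) : ℂ :=
  ∑ k ∈ range K, c k * (((w - 1 : ℝ) : ℂ) ^ (μ + k) * ((μ + k) / ((w : ℂ) - 1)))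

/-- Closed form of `F″` on `w > 1`. -/
def cpowSum₂ (μ : ℂ) (c : ℕ → ℂ) (K : ℕ) (w : ℝ) : ℂ :=
  ∑ k ∈ range K, c k *
    (((w - 1 : ℝ) : ℂ) ^ (μ + k) * ((μ + k) * (μ + k - 1) / ((w : ℂ) - 1) ^ 2))

/-- `F′ = cpowSum₁` on `w > 1`. -/
theorem hasDerivAt_cpowSum (μ : ℂ) (c : ℕ → ℂ) (K : ℕ) {w : ℝ} (hw : 1 < w) :
    HasDerivAt (cpowSum μ c K) (cpowSum₁ μ c K w) w := by
  unfold cpowSum cpowSum₁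
  exact HasDerivAt.fun_sum fun k _ => (hasDerivAt_sub_one_cpow (μ + k) hw).const_mul (c k)

/-- `F″ = cpowSum₂` on `w > 1`. -/
theorem hasDerivAt_cpowSum₁ (μ : ℂ) (c : ℕ → ℂ) (K : ℕ) {w : ℝ} (hw : 1 < w) :
    HasDerivAt (cpowSum₁ μ c K) (cpowSum₂ μ c K w) w := by
  have hne : ((w : ℂ) - 1) ≠ 0 := by
    have : ((w - 1 : ℝ) : ℂ) ≠ 0 := by exact_mod_cast (show w - 1 ≠ 0 by linarith)
    simpa using this
  have hc : HasDerivAt (fun t : ℝ => (t : ℂ)) 1 w := by simpa using (hasDerivAt_id w).ofReal_comp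
  unfold cpowSum₁ cpowSum₂
  refine HasDerivAt.fun_sum fun k _ => ?_
  have hD := hasDerivAt_sub_one_cpow (μ + k) hw
  have hinv : HasDerivAt (fun t : ℝ => (μ + k) / ((t : ℂ) - 1))
      (-((μ + k) * 1) / ((w : ℂ) - 1) ^ 2) w := by
    have := ((hc.sub_const (1 : ℂ)).inv hne).const_mul (μ + k)
    refine (this.congr_deriv (by field_simp)).congr_of_eventuallyEq ?_
    exact Filter.Eventually.of_forall fun t => by simp [div_eq_mul_inv]
  refine ((hD.mul hinv).const_mul (c k)).congr_deriv ?_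
  push_cast
  field_simp
  ring

/-- Each term, hence `F`, is smooth on `w > 1`. -/
theorem contDiffOn_cpowSum (μ : ℂ) (c : ℕ → ℂ) (K : ℕ) :
    ContDiffOn ℝ ((⊤ : ℕ∞) : WithTop ℕ∞) (cpowSum μ c K) (Ioi 1) := by
  have hterm : ∀ p : ℂ, ContDiffOn ℝ ((⊤ : ℕ∞) : WithTop ℕ∞)
      (fun w : ℝ => ((w - 1 : ℝ) : ℂ) ^ p) (Ioi 1) := by
    intro p x hx
    have hx' : (0 : ℝ) < x - 1 := sub_pos.2 hx
    have hslit : ((x - 1 : ℝ) : ℂ) ∈ slitPlane := Complex.ofReal_mem_slitPlane.2 hx'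
    have h1 : AnalyticAt ℂ (fun z : ℂ => z ^ p) ((x - 1 : ℝ) : ℂ) :=
      analyticAt_id.cpow analyticAt_const hslit
    have h3 : AnalyticAt ℝ (fun y : ℝ => ((y - 1 : ℝ) : ℂ)) x := by
      have : AnalyticAt ℝ (fun y : ℝ => (y : ℂ) - 1) x :=
        (Complex.ofRealCLM.analyticAt x).sub analyticAt_const
      refine this.congr (Filter.Eventually.of_forall fun y => ?_)
      push_cast; ring
    have h4 : AnalyticAt ℝ (fun y : ℝ => ((y - 1 : ℝ) : ℂ) ^ p) x :=
      AnalyticAt.comp (g := fun z : ℂ => z ^ p) (f := fun y : ℝ => ((y - 1 : ℝ) : ℂ)) (x := x)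
        h1.restrictScalars h3
    exact h4.contDiffAt.contDiffWithinAt
  unfold cpowSum
  exact ContDiffOn.sum fun k _ => contDiffOn_const.mul (hterm (μ + k))

/-- Explicit form: `F(w) = (w−1)^μ · Σ_{k<K} c_k (w−1)^k` for `w > 1`. -/
theorem cpowSum_eq (μ : ℂ) (c : ℕ → ℂ) (K : ℕ) {w : ℝ} (hw : 1 < w) :
    cpowSum μ c K w = ((w - 1 : ℝ) : ℂ) ^ μ * ∑ k ∈ range K, c k * ((w : ℂ) - 1) ^ k := by
  have hne : ((w - 1 : ℝ) : ℂ) ≠ 0 := by exact_mod_cast (show w - 1 ≠ 0 by linarith)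
  unfold cpowSum
  rw [mul_sum]
  refine sum_congr rfl fun k _ => ?_
  rw [Complex.cpow_add _ _ hne, Complex.cpow_natCast]
  push_cast
  ring

/-! ### The symbol -/

/-- `symbolSum(t) = Σ_{k<K} c_k t^k (X₀(μ+k) + X₁(μ+k)·t + X₂(μ+k)·t²)`. -/
def symbolSum (aH α β γ δ ε q μ : ℂ) (c : ℕ → ℂ) (K : ℕ) (t : ℂ) : ℂ :=
  ∑ k ∈ range K, c k * t ^ k *
    (symX₀ aH δ (μ + k) + symX₁ aH α β γ δ ε q (μ + k) * t + symX₂ α β γ δ ε (μ + k) * t ^ 2)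

/-- **The operator on a Frobenius sum.** For `w > 1`:
`lead·F″ + mid·F′ + low·F = (w−1)^{μ−1}·symbolSum(w−1)`. -/
theorem heunOp_cpowSum (aH α β γ δ ε q μ : ℂ) (c : ℕ → ℂ) (K : ℕ) {w : ℝ} (hw : 1 < w) :
    lead aH w * cpowSum₂ μ c K w + mid aH γ δ ε w * cpowSum₁ μ c K w +
        low α β q w * cpowSum μ c K w =
      ((w - 1 : ℝ) : ℂ) ^ (μ - 1) * symbolSum aH α β γ δ ε q μ c K ((w : ℂ) - 1) := by
  have hne' : ((w - 1 : ℝ) : ℂ) ≠ 0 := by exact_mod_cast (show w - 1 ≠ 0 by linarith)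
  have hne : ((w : ℂ) - 1) ≠ 0 := by simpa using hne'
  unfold cpowSum cpowSum₁ cpowSum₂ symbolSum
  rw [mul_sum, mul_sum, mul_sum, mul_sum, ← sum_add_distrib, ← sum_add_distrib]
  refine sum_congr rfl fun k _ => ?_
  have hsplit : ((w - 1 : ℝ) : ℂ) ^ (μ + k) =
      ((w - 1 : ℝ) : ℂ) ^ (μ - 1) * (((w : ℂ) - 1) ^ k * ((w : ℂ) - 1)) := by
    rw [show μ + (k : ℂ) = (μ - 1) + ((k + 1 : ℕ) : ℂ) by push_cast; ring,
      Complex.cpow_add _ _ hne', Complex.cpow_natCast, pow_succ]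
    push_cast
    ring
  rw [hsplit]
  unfold lead mid low symX₀ symX₁ symX₂
  push_cast
  field_simp
  ring

/-! ### Solutions versus the symbol -/

/-- If the symbol vanishes along `(1, b)` then `F` is a classical solution there. -/
theorem isSolutionOn_cpowSum {aH α β γ δ ε q μ : ℂ} {c : ℕ → ℂ} {K : ℕ} {b : ℝ}
    (hsym : ∀ w ∈ Ioo 1 b, symbolSum aH α β γ δ ε q μ c K ((w : ℂ) - 1) = 0) :
    IsSolutionOn aH α β γ δ ε q (Ioo 1 b) (cpowSum μ c K) := by
  refine ⟨cpowSum₁ μ c K, cpowSum₂ μ c K, fun w hw =>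
    ⟨hasDerivAt_cpowSum μ c K hw.1, hasDerivAt_cpowSum₁ μ c K hw.1, ?_⟩⟩
  rw [heunOp_cpowSum aH α β γ δ ε q μ c K hw.1, hsym w hw, mul_zero]

/-- Conversely, along an interval of solution the symbol vanishes. -/
theorem symbolSum_eq_zero_of_isSolutionOn {aH α β γ δ ε q μ : ℂ} {c : ℕ → ℂ} {K : ℕ} {b : ℝ}
    (hsol : IsSolutionOn aH α β γ δ ε q (Ioo 1 b) (cpowSum μ c K)) :
    ∀ w ∈ Ioo 1 b, symbolSum aH α β γ δ ε q μ c K ((w : ℂ) - 1) = 0 := by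
  obtain ⟨f₁, f₂, h⟩ := hsol
  intro w hw
  obtain ⟨h1, h2, h3⟩ := h w hw
  have e1 : f₁ w = cpowSum₁ μ c K w := h1.unique (hasDerivAt_cpowSum μ c K hw.1)
  have hev : f₁ =ᶠ[𝓝 w] cpowSum₁ μ c K := by
    filter_upwards [isOpen_Ioo.mem_nhds hw] with t ht using
      (h t ht).1.unique (hasDerivAt_cpowSum μ c K ht.1)
  have e2 : f₂ w = cpowSum₂ μ c K w :=
    (h2.congr_of_eventuallyEq hev.symm).unique (hasDerivAt_cpowSum₁ μ c K hw.1)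
  rw [e1, e2, heunOp_cpowSum aH α β γ δ ε q μ c K hw.1] at h3
  exact (mul_eq_zero.mp h3).resolve_left (sub_one_cpow_ne_zero _ hw.1)

/-! ### The symbol versus the recurrence -/

/-- **Regrouping by powers.** For `c` supported in `k < K`:
`symbolSum(t) = Σ_{n<K+2} recCoeff_n t^n`. -/
theorem symbolSum_eq_sum_recCoeff {aH α β γ δ ε q μ : ℂ} {c : ℕ → ℂ} {K : ℕ}
    (hc : ∀ k, K ≤ k → c k = 0) (t : ℂ) :
    symbolSum aH α β γ δ ε q μ c K t =
      ∑ n ∈ range (K + 2), recCoeff aH α β γ δ ε q μ c n * t ^ n := by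
  -- the three families of terms
  set g₀ : ℕ → ℂ := fun k => c k * symX₀ aH δ (μ + k) * t ^ k with hg₀
  set g₁ : ℕ → ℂ := fun k => c k * symX₁ aH α β γ δ ε q (μ + k) * t ^ (k + 1) with hg₁
  set g₂ : ℕ → ℂ := fun k => c k * symX₂ α β γ δ ε (μ + k) * t ^ (k + 2) with hg₂
  have hS : symbolSum aH α β γ δ ε q μ c K t =
      ∑ k ∈ range K, g₀ k + ∑ k ∈ range K, g₁ k + ∑ k ∈ range K, g₂ k := by
    unfold symbolSum
    rw [← sum_add_distrib, ← sum_add_distrib]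
    exact sum_congr rfl fun k _ => by simp only [hg₀, hg₁, hg₂]; ring
  -- vanishing tails
  have hz₀ : g₀ K = 0 := by simp only [hg₀]; rw [hc K le_rfl]; ring
  have hz₀' : g₀ (K + 1) = 0 := by simp only [hg₀]; rw [hc (K + 1) (by omega)]; ring
  have hz₁ : g₁ K = 0 := by simp only [hg₁]; rw [hc K le_rfl]; ring
  -- re-indexing the two shifted families
  have hA : ∑ k ∈ range K, g₀ k = ∑ k ∈ range K, g₀ (k + 2) + g₀ 1 + g₀ 0 := by
    have h := (sum_range_succ g₀ K)
    have h' := (sum_range_succ g₀ (K + 1))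
    have h'' : ∑ k ∈ range (K + 2), g₀ k = ∑ k ∈ range K, g₀ (k + 1 + 1) + g₀ (0 + 1) + g₀ 0 := by
      rw [sum_range_succ', sum_range_succ']
    simp only [zero_add] at h''
    rw [hz₀] at h
    rw [hz₀'] at h'
    rw [← h'', h', h]
    ring
  have hB : ∑ k ∈ range K, g₁ k = ∑ k ∈ range K, g₁ (k + 1) + g₁ 0 := by
    have h := sum_range_succ g₁ K
    have h'' : ∑ k ∈ range (K + 1), g₁ k = ∑ k ∈ range K, g₁ (k + 1) + g₁ 0 := sum_range_succ' g₁ K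
    rw [hz₁] at h
    rw [← h'', h, add_zero]
  -- the right-hand side, peeled twice
  have hR : ∑ n ∈ range (K + 2), recCoeff aH α β γ δ ε q μ c n * t ^ n =
      ∑ n ∈ range K, recCoeff aH α β γ δ ε q μ c (n + 2) * t ^ (n + 2) +
        recCoeff aH α β γ δ ε q μ c 1 * t ^ 1 + recCoeff aH α β γ δ ε q μ c 0 * t ^ 0 := by
    rw [sum_range_succ', sum_range_succ']
  have hmain : ∑ n ∈ range K, recCoeff aH α β γ δ ε q μ c (n + 2) * t ^ (n + 2) =
      ∑ k ∈ range K, g₀ (k + 2) + ∑ k ∈ range K, g₁ (k + 1) + ∑ k ∈ range K, g₂ k := by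
    rw [← sum_add_distrib, ← sum_add_distrib]
    refine sum_congr rfl fun n _ => ?_
    simp only [recCoeff, hg₀, hg₁, hg₂]
    push_cast
    ring
  have e0 : recCoeff aH α β γ δ ε q μ c 0 * t ^ 0 = g₀ 0 := by
    simp only [recCoeff, hg₀]; push_cast; ring
  have e1 : recCoeff aH α β γ δ ε q μ c 1 * t ^ 1 = g₀ 1 + g₁ 0 := by
    simp only [recCoeff, hg₀, hg₁]; push_cast; ring
  rw [hS, hA, hB, hR, hmain, e0, e1]
  ring

/-- If every recurrence coefficient vanishes, the symbol vanishes identically. -/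
theorem symbolSum_eq_zero_of_recCoeff {aH α β γ δ ε q μ : ℂ} {c : ℕ → ℂ} {K : ℕ}
    (hc : ∀ k, K ≤ k → c k = 0) (hrec : ∀ n, recCoeff aH α β γ δ ε q μ c n = 0) (t : ℂ) :
    symbolSum aH α β γ δ ε q μ c K t = 0 := by
  rw [symbolSum_eq_sum_recCoeff hc]
  exact sum_eq_zero fun n _ => by rw [hrec n, zero_mul]

/-- Coefficients of a finite power sum vanishing on a real interval are zero. -/
theorem coeff_eq_zero_of_sum_eval_eq_zero {r : ℕ → ℂ} {K : ℕ} {a b : ℝ} (hab : a < b)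
    (h : ∀ s : ℝ, s ∈ Ioo a b → ∑ n ∈ range K, r n * (s : ℂ) ^ n = 0) :
    ∀ n, n < K → r n = 0 := by
  set P : Polynomial ℂ := ∑ n ∈ range K, C (r n) * X ^ n with hPdef
  have hP : ∀ s ∈ Ioo a b, P.eval (s : ℂ) = 0 := by
    intro s hs
    rw [← h s hs, hPdef, eval_finsetSum]
    simp only [eval_mul, eval_C, eval_pow, eval_X]
  have hP0 : P = 0 := by
    apply eq_zero_of_infinite_isRoot
    have hinf : (((↑) : ℝ → ℂ) '' Ioo a b).Infinite :=
      (Ioo_infinite hab).image Complex.ofReal_injective.injOn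
    refine hinf.mono ?_
    rintro _ ⟨x, hx, rfl⟩
    exact hP x hx
  intro n hn
  have hcoef := congrArg (fun Q : Polynomial ℂ => Q.coeff n) hP0
  simp only [hPdef, finsetSum_coeff, coeff_C_mul_X_pow, coeff_zero] at hcoef
  rw [sum_ite_eq (range K) n r, if_pos (mem_range.mpr hn)] at hcoef
  exact hcoef

/-- **A Frobenius-polynomial solution satisfies the recurrence.** -/
theorem recCoeff_eq_zero_of_isSolutionOn {aH α β γ δ ε q μ : ℂ} {c : ℕ → ℂ} {K : ℕ} {b : ℝ}
    (hb : 1 < b) (hc : ∀ k, K ≤ k → c k = 0)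
    (hsol : IsSolutionOn aH α β γ δ ε q (Ioo 1 b) (cpowSum μ c K)) :
    ∀ n, recCoeff aH α β γ δ ε q μ c n = 0 := by
  have hsym := symbolSum_eq_zero_of_isSolutionOn hsol
  have hpoly : ∀ s : ℝ, s ∈ Ioo 0 (b - 1) →
      ∑ n ∈ range (K + 2), recCoeff aH α β γ δ ε q μ c n * (s : ℂ) ^ n = 0 := by
    intro s hs
    have hw : s + 1 ∈ Ioo 1 b := ⟨by linarith [hs.1], by linarith [hs.2]⟩
    have := hsym (s + 1) hw
    rw [symbolSum_eq_sum_recCoeff hc] at this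
    push_cast at this
    simpa using this
  have hK := coeff_eq_zero_of_sum_eval_eq_zero (by linarith) hpoly
  intro n
  by_cases hn : n < K + 2
  · exact hK n hn
  · exact recCoeff_eq_zero_of_le hc (by omega)

/-- **`F ≡ 0` on `(1, b)` forces all coefficients to vanish.** -/
theorem coeff_eq_zero_of_cpowSum_eq_zero {μ : ℂ} {c : ℕ → ℂ} {K : ℕ} {b : ℝ} (hb : 1 < b)
    (h : ∀ w ∈ Ioo 1 b, cpowSum μ c K w = 0) : ∀ k, k < K → c k = 0 := by
  refine coeff_eq_zero_of_sum_eval_eq_zero (a := 0) (b := b - 1) (by linarith) fun s hs => ?_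
  have hw : (1 : ℝ) < s + 1 := by linarith [hs.1]
  have h0 := h (s + 1) ⟨hw, by linarith [hs.2]⟩
  rw [cpowSum_eq μ c K hw] at h0
  have h1 := (mul_eq_zero.mp h0).resolve_left (sub_one_cpow_ne_zero μ hw)
  push_cast at h1
  simpa using h1

/-! ### The formal Euler partner is a solution -/

/-- **The formal Euler transform of a Frobenius-polynomial solution solves the image equation.**
If `Σ_{k≤D} c_k (w−1)^{ρ+k}` (coefficients supported in `k ≤ D`) solves `Hn(a_H; α,β; γ,δ,ε; q)`
on some `(1, b)`, `b > 1`, where `ρ = 1 − δ`, the Fuchs relation holds and `(η−α)(η−β) = 0`, then the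
partner `Σ_{k≤D} b_k (w−1)^{ρ+η−1+k}` solves Takemura's image equation
`Hn(a_H; 2−η, α+β−2η+1; γ−η+1, δ−η+1, ε−η+1; q′)` on every `(1, b′)`. -/
theorem isSolutionOn_partner {aH α β γ δ ε q η ρ : ℂ} {D : ℕ} {c : ℕ → ℂ} {b : ℝ} (hb : 1 < b)
    (hF : γ + δ + ε = α + β + 1) (hroot : (η - α) * (η - β) = 0) (hρ : ρ = 1 - δ)
    (hc : ∀ k, D < k → c k = 0)
    (hsol : IsSolutionOn aH α β γ δ ε q (Ioo 1 b) (cpowSum ρ c (D + 1))) (b' : ℝ) :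
    IsSolutionOn aH (eulerSrcα η) (eulerSrcβ α β η) (eulerSrc γ η) (eulerSrc δ η) (eulerSrc ε η)
      (eulerSrcQ aH γ δ ε q η) (Ioo 1 b') (cpowSum (ρ + η - 1) (partnerCoeff ρ η D c) (D + 1)) := by
  have hc' : ∀ k, D + 1 ≤ k → c k = 0 := fun k hk => hc k (by omega)
  have hsrc := recCoeff_eq_zero_of_isSolutionOn hb hc' hsol
  have himg := recCoeff_partner_eq_zero (aH := aH) (q := q) hF hroot hρ hc hsrc
  have hb' : ∀ k, D + 1 ≤ k → partnerCoeff ρ η D c k = 0 :=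
    fun k hk => partnerCoeff_eq_zero (hc k (by omega))
  exact isSolutionOn_cpowSum fun w _ => symbolSum_eq_zero_of_recCoeff hb' himg _

end SpinFlipTS

end Summit.Ventures.KdS
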